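import Mathlib
import Literature.NumberTheory.Automorphic.ZhouLegendreGreenValuesProofs
import Literature.NumberTheory.Automorphic.ZhouGreenLevelOneValue
import Literature.NumberTheory.Automorphic.ZhouGreenLevelTwoValue
import Literature.NumberTheory.Automorphic.ZhouGreenLevelThreeValue
import HarnessLib

/-!
# Zhou 2015, Remark 9: the discharge `Zhou2015_legendreP_sq_integral_holds`

[topic NumberTheory/Automorphic]

The named fact `Literature.NumberTheory.Automorphic.Zhou2015_legendreP_sq_integral`
(`ZhouLegendreGreenValues.lean`; Zhou 2015, Remark 9: the closed form of `π∫₀¹[P_ν(ξ)]²dξ` and the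
three weight-4 automorphic Green's function values `G₂^{PSL₂ℤ}(e^{πi/3}, i)`, `G₂^{Γ₀(2)}((i−1)/2, i/√2)`,
`G₂^{Γ₀(3)}((3+i√3)/6, i/√3)`) is proved by assembling

* conjunct (i) and the three integral evaluations (ii)b–(iv)b of `ZhouLegendreGreenValuesProofs.lean`,
* the three Green's function values (ii)a–(iv)a of `ZhouGreenLevelOneValue.lean`,
  `ZhouGreenLevelTwoValue.lean`, `ZhouGreenLevelThreeValue.lean` (Eichler-integral constructions on
  `PSL₂(ℤ)`, `Γ₀(2)⁺`, `Γ₀(3)⁺` matched with `higherGreen N 2 1` by uniqueness of resolvent Green functions,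
  and the Fricke–Klein / Ramanujan signature-`4` / signature-`3` identities on the imaginary axis),

through the reduction `LegendreP.Zhou2015_legendreP_sq_integral_of_green`.

## References

* Y. Zhou, *Kontsevich–Zagier integrals for automorphic Green's functions. I*, Ramanujan J. 38
  (2015) 227–329, Remark 9 (arXiv:1312.6352, p. 19). [cite: Zhou2015, Remark 9]
-/

noncomputable section

open Real MeasureTheory intervalIntegral

namespace Literature.NumberTheory.Automorphic

open LegendreP

/-- **Zhou 2015, Remark 9 (all four displayed formulas).** [cite: Zhou2015, Remark 9 (arXiv p. 19)] -/
theorem Zhou2015_legendreP_sq_integral_holds : Zhou2015_legendreP_sq_integral := by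
  have hπ : (π : ℝ) ≠ 0 := Real.pi_ne_zero
  have h3 : (√3 : ℝ) ≠ 0 := by positivity
  have h3sq : (√3 : ℝ) * √3 = 3 := Real.mul_self_sqrt (by norm_num)
  have h2 : (√2 : ℝ) ≠ 0 := by positivity
  refine Zhou2015_legendreP_sq_integral_of_green ?_ ?_ ?_
  · rw [higherGreen_one_two_one_cmRho_I, integral_legendreP_neg_one_sixth_sq]
    field_simp
    ring
  · rw [higherGreen_two_cmLevelTwo_cmLevelTwo', integral_legendreP_neg_one_quarter_sq]
    field_simp
    ring
  · rw [higherGreen_three_cmLevelThree_cmLevelThree', integral_legendreP_neg_one_third_sq]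
    field_simp

end Literature.NumberTheory.Automorphic

end
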